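/-
Copyright (c) 2026 the pub-hodgecm2 formalisation cell (harness21).  New file.
Origin: seat `prover-pub-hodgecm2-b28-g41-0` (unit pub-hodgecm2-b28, KERNEL CONE-AUDIT seat, gen 41), 2026-08-25, on the call of
`literature-prover-pub-hodgecm2-infra07f1-g64-0` (HOME/INBOX 2026-08-25T05:04:10Z: "the PRINT hypothesis `hvN` of the StubTree
headlines is dischargeable by a ONE-LINER … ACTION for a PROVER seat").  KERNEL only: one discharge of a named PRINT fact of the
ported stage-1 package by a Literature THEOREM of the tree; no hypothesis binder of the Hodge kind (T5: n/a-class); no statement of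
the package or of the COR-CM E term is re-displayed or changed.  HC_CM is NOT proved.
-/
import Summits.HodgeConjecture.HodgeCM.StubTree.ExpandFromTower
import Literature.Analysis.OperatorTheory.DoubleCommutantDensity
import HarnessLib

set_option autoImplicit false

noncomputable section

/-!
# PORT JOIN: the stub-tree PRINT hypothesis `hvN` (von Neumann's double commutant theorem, density half) is a theorem

The ported stage-1 stub tree (`Summits/HodgeConjecture/HodgeCM/StubTree/ExpandFromTower.lean`, `ComponentTower.lean`,
`ComponentTowerTwist.lean`) carries von Neumann's double commutant theorem, density half — Pedersen, *Analysis Now* 4.6.7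
(iii) ⟹ (i) / 4.6.8 Corollary — as the named PRINT `Prop` `HodgeCM.Literature.VonNeumann.DoubleCommutantDensity`
(`ExpandFromTower.lean`), taken as the hypothesis `hvN` of `IsoDatum.expand_of_tower`, `IsoDatum.expand_of_compTower`,
`matsushima{Tower,}Free{Face,PerL}_of_{block,comp}`, `periodThmF_of_liu_{block,comp}`, `perL44_of_liu_{block,comp}`,
`COR_CM_of_liu_{block,comp,twist}` and `perL_of_liu_{block,comp,twist}` (53 occurrences).  The Literature file
`Literature/Analysis/OperatorTheory/DoubleCommutantDensity.lean` proves exactly this statement, binder for binder, as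
`Literature.Analysis.OperatorTheory.doubleCommutant_density` (amplification `B(ℌ) → B(ℌⁿ)` + the one-vector step, following the
printed proof).  This file records the consequence for the stub tree: `hvN` is discharged —
`HodgeCM.Literature.VonNeumann.doubleCommutantDensity_holds : DoubleCommutantDensity` — so every headline above holds with
`hvN := Literature.VonNeumann.doubleCommutantDensity_holds` fed, its other hypotheses (`ModelAxioms`, `LiuSupplyFace` /
`LiuSupplyPerL`, the Matsushima–tower package, `PohlmannSpan`, `Qw8Sufficiency`) unchanged.  No headline is re-displayed here.
The fact is not a binder of the COR-CM E term of record or of its `hM` / `h418` cone; nothing about those displays changes.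
-/

namespace HodgeCM.Literature.VonNeumann

/-- **von Neumann's double commutant theorem, density half — HOLDS** (discharge of the named PRINT fact
`HodgeCM.Literature.VonNeumann.DoubleCommutantDensity`, the stub-tree hypothesis `hvN`): for every complex Hilbert space `ℌ` and
every set `𝒮 ∋ 1` of bounded operators on `ℌ` closed under composition and under adjoints, every `T ∈ 𝒮″` is strongly
approximable from `span ℂ 𝒮` — for each finite set `F` of vectors and each `ε > 0` some `b ∈ span ℂ 𝒮` has `‖T x - b x‖ < ε` for
all `x ∈ F`.  One line: the tree theorem `Literature.Analysis.OperatorTheory.doubleCommutant_density`, whose statement is the body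
of the named `Prop` argument for argument.
[cite: Pedersen1989, 4.6.7 Theorem (iii)⟹(i) and 4.6.8 Corollary, pp. 203–204] -/
theorem doubleCommutantDensity_holds : DoubleCommutantDensity :=
  fun _ _ _ _ 𝒮 h1 hmul hadj T hT F ε hε =>
    _root_.Literature.Analysis.OperatorTheory.doubleCommutant_density 𝒮 h1 hmul hadj T hT F ε hε

end HodgeCM.Literature.VonNeumann

end
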